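import Summits.HodgeConjecture.HodgeConjecture.Theses.HolomorphicityRate

/-!
# Route HolomorphicityRate — `TargetOfCruxes` (item stmt-HodgeConjecture-14253)

Pure-logic glue: the two ranked cruxes `RateGap` (R1) and `SuperThresholdRigidity` (R2) deliver the
route target `Target` (X₀).  For `X` smooth projective of dimension `n`, `p ≤ n`, a Hodge model `A`
and a rational class `c` with `A.pullback c` of type `(p,p)`, R1 supplies the ray data
(`g`, `m ≥ 1`, `hp` rational algebraic, `C`, `a_k ≤ C·k^p`, `δ > 0`, `C'`) together with
super-threshold nearly-holomorphic supports of `m•c + a_k•hp` for infinitely many `k` — syntactically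
the hypotheses of R2 — and R2 returns one `k` and a closed analytic `S ⊆ X^an` with regular points of
codimension `≥ p` off which `m•c + a_k•hp` dies.  Take `b := a_k•hp`, algebraic because
`algebraicClasses X p` is a `ℂ`-submodule (`Submodule.smul_mem`).  No mathematical content beyond
bookkeeping.
-/

-- `Summit.HodgeConjecture.HodgeConjecture.Theorems` is the mandated namespace (single-problem summit:
-- Problem = Summit), which `linter.dupNamespace` flags on every declaration; the lakefile turns the
-- linter off for the Summits library (weak option), restated here so stand-alone elaboration is warning-free.
set_option linter.dupNamespace false

namespace Summit.HodgeConjecture.HodgeConjecture.Theorems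

/-- **Item stmt-HodgeConjecture-14253 (`TargetOfCruxes`)**:
`RateGap → SuperThresholdRigidity → Target`.
Given `X` smooth projective of dimension `n`, `p ≤ n`, a Hodge model `A` and a rational class `c`
whose pull-back to `A` is of type `(p,p)`, `RateGap` produces the ray data
`g, m, hp, C, a, δ, C'` with `0 < m`, `hp` rational and algebraic, the budget `a k ≤ C·k^p`, `0 < δ`
and, frequently in `k`, super-threshold nearly-holomorphic supports of `m•c + (a k)•hp`; these are
literally the hypotheses of `SuperThresholdRigidity`, which returns some `k` and a closed analytic
`S` (regular points of codimension `≥ p`) off which `m•c + (a k)•hp` dies.  The target's witnesses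
are `m`, `b := (a k)•hp` (algebraic by `Submodule.smul_mem`) and `S`.  The type is literally the
route decl `Summit.HodgeConjecture.HodgeConjecture.Theses.HolomorphicityRate.TargetOfCruxes`. -/
theorem holomorphicityRate_targetOfCruxes_proof :
    Summit.HodgeConjecture.HodgeConjecture.Theses.HolomorphicityRate.TargetOfCruxes := by
  unfold Summit.HodgeConjecture.HodgeConjecture.Theses.HolomorphicityRate.TargetOfCruxes
  intro h₁ h₂ n p X hX hp A c hc hA
  obtain ⟨g, m, hp', C, a, δ, C', hm, hrat, halg, hbud, hδ, hfreq⟩ := h₁ n p X hX hp A c hc hA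
  obtain ⟨k, S, hS, hsupp⟩ := h₂ n p X hX hp A g c hp' m C a δ C' hrat halg hm hbud hδ hfreq
  exact ⟨m, ((a k : ℕ) : ℂ) • hp', S, hm, Submodule.smul_mem _ _ halg, hS, hsupp⟩

end Summit.HodgeConjecture.HodgeConjecture.Theorems
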